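import Summits.BirchSwinnertonDyer.BirchSwinnertonDyer.Theorems.ByReductionTypeAtTwoFineSelmerConjAAtTwoAdditivePotGoodNarrowRankCertificate63644Layer
import Summits.BirchSwinnertonDyer.BirchSwinnertonDyer.Theorems.ByReductionTypeAtTwoFineSelmerConjAAtTwoAdditivePotGoodNarrowRankCertificate63644Dyadic
import Literature.NumberTheory.NumberFields.QuadraticExtensionOddClassNumberNonNormUnit
import Literature.NumberTheory.NumberFields.SqrtGeneratorUnramified
import HarnessLib

/-!
# Route `ByReductionTypeAtTwo` (rung K4), crux C1″ `FineSelmerConjAAtTwoAdditivePotGood` (item stmt-BirchSwinnertonDyer-22615):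
# THE LAYER-`1` FIELD `A = ℚ(θ) ⊔ ℚ_1 = ℚ(θ, √2)` OF THE CUBIC FIELD OF DISCRIMINANT `63644`, PART B — `#(U⁺/U²)(A) = 2`, `h(A)` ODD, and
# `[Cl⁺(A) : Cl⁺(A)²] = 2 = [Cl⁺(ℚ(θ)) : Cl⁺(ℚ(θ))²]`: the narrow rank certificate of the census row `445508b1` (KERNEL)
# (a `--supports 22615` file; seat `bsd-2adic-k4-w1` GEN 10; sequel of `…NarrowRankCertificate63644Layer`)

HONEST FRAMING (cell `bsd-2adic`, D-0036/D-0054/D-0152): KERNEL theorems about ONE totally real sextic field; no elliptic curve, no named fact, no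
`sorry`, no definition. Closes nothing at the `∀`-level; nothing booked; BSD is not proved by any of this.

THE CERTIFICATE (`b = θ`, `ω = (1+θ²)/2`, `s = √2`; real roots `r₀ ≈ −7.2668 < r₁ ≈ 2.1304 < r₂ ≈ 6.1364`; units found by the seat's lattice
search `work/num/` in the integral basis `𝓞_E ⊕ 𝓞_E·(s/π₁)` and verified EXACTLY here): the five units `−1`, `ε = −10969 + 278b + 246b²` (from `E`),
`1 + s`, `e₄ = (12 − 5b) + (b − ω)s` (relative norm `1`), `e₅ = (−580 + 283b + 98ω) + (845 − 191b − 83ω)s` (relative norm `−h₂`,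
`h₂ = 567201 − 176732b − 68820ω = −u⁻¹`) have, at the five real embeddings `(r₀,−√2)`, `(r₁,+√2)`, `(r₁,−√2)`, `(r₂,+√2)`, `(r₂,−√2)`, the sign
matrix `[[1,1,1,1,1],[0,1,1,0,0],[1,0,1,0,1],[0,0,0,1,1],[0,0,1,0,0]]`, INVERTIBLE over `𝔽₂` ⟹ `#sign(U) ≥ 2⁵`; the embedding `(r₀,+√2)` is avoided
(there `e₅ ≈ 4·10⁻⁷`), and the three delicate entries (`e₄` at `(r₁,+)`, `(r₂,−)`: `0.44`, `−0.027`; `e₅` at `(r₁,−)`: `−0.16`) are certified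
through the INVERSE unit (`σ(e)σ(e⁻¹) = 1`, `e₄⁻¹ = ē₄`, `e₅⁻¹ = ē₅·u`), whose value is a same-sign sum. With `u₀` totally positive and not a
unit square in `A` (part A): **`#(U⁺/U²)(A) = 2`**. PARITY: `A/E` is quadratic, totally real, ramified at most at the two primes `(π₁)`, `(π₂)`
above `2` (a prime `∌ 8` is unramified, tree `isUnramifiedAt_of_sq_eq`), and `ε` is not a norm from `A` (`…63644Dyadic`), so by the tree's
genus-theory lemma `AmbiguousClass.odd_classNumber_of_quadratic_of_isTotallyReal_of_forall_sq_sub_mul_sq_ne` (this seat) **`h(A)` is ODD**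
(`h(E) = 1` kernel). Hence (tree `index_range_pow_two_narrowClassGroup_eq_card_totPosUnitsModSq_of_odd_classNumber`, this seat)
**`[Cl⁺(A) : Cl⁺(A)²] = 2 = [Cl⁺(E) : Cl⁺(E)²]`** — the hypothesis `hr` of the narrow-Fukuda door `conjA_two_of_narrowRank_sqrtTwo_model_pointField`
(cruxlead-19573-w2 GEN 9, p740352) for the row `445508b1`, whose kit record (addL2x GEN 8 j300990: `F3(i) n0=0 R`, `cyc6 = []`) is thereby KERNEL.

* `layer_unit_ids_d63644` — the unit identities in any commutative ring with the relations of `ℤ[θ, ω, √2]`.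
* **`card_totPosUnitsModSq_adjoin_sup_layer_one_d63644`** (`= 2`).
* **`odd_classNumber_adjoin_sup_layer_one_d63644`**, **`index_range_pow_two_narrowClassGroup_adjoin_sup_layer_one_d63644`** (`= 2`).

References: [FrohlichTaylor1990] Ch. V §1 (1.10)–(1.13); [Lang1990] Ch. 13 §4 Lemma 4.1; [Washington1997] §13.1; [Cohen1993] §4.1.3, §6.3;
[NeukirchANT1999] Ch. III (2.6) (different and ramification).
-/

set_option autoImplicit false
-- sibling precedent: the directory name repeats the summit name
set_option linter.dupNamespace false

noncomputable section

open scoped Classical IntermediateField NumberField nonZeroDivisors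

namespace Summit.BirchSwinnertonDyer.BirchSwinnertonDyer.Theorems.AddKatoTwo

open Polynomial IsDedekindDomain NumberField Field IntermediateField
  Literature.NumberTheory.EllipticCurves Literature.NumberTheory.EllipticCurves.ZpExtension
  Literature.NumberTheory.IwasawaTheory Literature.NumberTheory.NumberFields
  Literature.NumberTheory.GaloisRepresentations Literature.Geometry.Kaehler.ComplexTorus

variable {θ : AlgebraicClosure ℚ}

/-- The unit identities of the certificate in any commutative ring with `b² = 2ω − 1`, `bω = ω + 24b − 48`, `ω² = 25ω − 12b − 36`, `s² = 2`:
`(1+s)(−1+s) = 1`; `e₄ ē₄ = 1`; `e₅ (ē₅ u) = 1`; `ε ε' = 1`; `u·(−h₂) = 1` (see the module docstring for the elements). [folklore] -/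
theorem layer_unit_ids_d63644 {R : Type*} [CommRing R] (b ω s : R) (R1 : b ^ 2 = 2 * ω - 1) (R2 : b * ω = ω + 24 * b - 48)
    (R3 : ω ^ 2 = 25 * ω - 12 * b - 36) (hs : s ^ 2 = 2) :
    (1 + s) * (-1 + s) = 1 ∧
    ((12 - 5 * b) + (b - ω) * s) * ((12 - 5 * b) - (b - ω) * s) = 1 ∧
    ((-580 + 283 * b + 98 * ω) + (845 - 191 * b - 83 * ω) * s) *
      (((-580 + 283 * b + 98 * ω) - (845 - 191 * b - 83 * ω) * s) * (16593903 - 11362268 * b + 2748892 * ω)) = 1 ∧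
    (-10969 + 278 * b + 246 * b ^ 2) * (-3189 + 1058 * b + 206 * b ^ 2) = 1 ∧
    (16593903 - 11362268 * b + 2748892 * ω) * (-(567201 - 176732 * b - 68820 * ω)) = 1 := by
  refine ⟨?_, ?_, ?_, ?_, ?_⟩
  · linear_combination ((1 : R)) * hs
  · linear_combination ((25 : R) + (-1 : R) * s ^ 2) * R1 + ((2 : R) * s ^ 2) * R2 + ((-1 : R) * s ^ 2) * R3 + ((-59 : R) + (-25 : R) * ω + (60 : R) * b) * hs
  · linear_combination ((5058994436407 : R) + (-4272988663063 : R) * s ^ 2 + (-410086270036 : R) * ω + (259969740156 : R) * ω * s ^ 2 + (-909992681852 : R) * b + (414506898908 : R) * b * s ^ 2) * R1 + ((213352973180 : R) + (-389498502526 : R) * s ^ 2 + (43352319584 : R) * ω + (-8881705500 : R) * ω * s ^ 2) * R2 + ((-269937449436 : R) + (308901533185 : R) * s ^ 2 + (26400358768 : R) * ω + (-18937116988 : R) * ω * s ^ 2) * R3 + ((76 : R) + (-105 : R) * ω + (318 : R) * b) * hs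
  · linear_combination ((-2800660 : R) + (101352 : R) * ω + (317536 : R) * b + (50676 : R) * b ^ 2) * R1 + ((635072 : R)) * R2 + ((202704 : R)) * R3
  · linear_combination ((-2008076348176 : R)) * R1 + ((-296134102816 : R)) * R2 + ((189178747440 : R)) * R3

/-- If `a · c = 1` and `0 < c` then `0 < a`; if `c < 0` then `a < 0` (real numbers). [folklore] -/
private theorem pos_of_mul_eq_one {a c : ℝ} (h : a * c = 1) (hc : 0 < c) : 0 < a := by
  by_contra hle; push Not at hle; nlinarith

/-- If `a · c = 1` and `c < 0` then `a < 0` (real numbers). [folklore] -/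
private theorem neg_of_mul_eq_one {a c : ℝ} (h : a * c = 1) (hc : c < 0) : a < 0 := by
  by_contra hle; push Not at hle; nlinarith

/-- If `a · c = −1` and `0 < c` then `a < 0` (real numbers). [folklore] -/
private theorem neg_of_mul_eq_neg_one {a c : ℝ} (h : a * c = -1) (hc : 0 < c) : a < 0 := by
  by_contra hle; push Not at hle; nlinarith

/-- If `a · c = −1` and `c < 0` then `0 < a` (real numbers). [folklore] -/
private theorem pos_of_mul_eq_neg_one {a c : ℝ} (h : a * c = -1) (hc : c < 0) : 0 < a := by
  by_contra hle; push Not at hle; nlinarith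

set_option maxHeartbeats 1600000 in
/-- **`#(U⁺/U²)(ℚ(θ) ⊔ ℚ_1) = 2` for `θ³ − θ² − 47θ + 95 = 0`** (`ℚ(θ, √2)`, totally real sextic, narrow defect `1`), KERNEL — five units with an
invertible sign matrix at five real embeddings, and the non-square totally positive unit `u₀` (see the module docstring).
[cite: FrohlichTaylor1990, Ch. V §1 (1.12)–(1.13), p. 164] [cite: Cohen1993, §4.1.3] [cite: Washington1997, §13.1] -/
theorem card_totPosUnitsModSq_adjoin_sup_layer_one_d63644
    (hθ : aeval θ (Cubic.toPoly ⟨1, ((-1 : ℤ) : ℚ), ((-47 : ℤ) : ℚ), ((95 : ℤ) : ℚ)⟩) = 0) :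
    haveI : FiniteDimensional ℚ ↥ℚ⟮θ⟯ :=
      IntermediateField.adjoin.finiteDimensional ⟨_, Cubic.monic_of_a_eq_one', by rwa [← aeval_def]⟩
    haveI : FiniteDimensional ℚ ↥((CyclotomicZp.zpExtension 2).layer 1) := (CyclotomicZp.zpExtension 2).finiteDimensional_layer_holds 1
    haveI : NumberField ↥(ℚ⟮θ⟯ ⊔ (CyclotomicZp.zpExtension 2).layer 1) := NumberField.mk
    Nat.card (TotPosUnitsModSq ↥(ℚ⟮θ⟯ ⊔ (CyclotomicZp.zpExtension 2).layer 1)) = 2 := by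
  haveI : FiniteDimensional ℚ ↥ℚ⟮θ⟯ :=
    IntermediateField.adjoin.finiteDimensional ⟨_, Cubic.monic_of_a_eq_one', by rwa [← aeval_def]⟩
  haveI : FiniteDimensional ℚ ↥((CyclotomicZp.zpExtension 2).layer 1) := (CyclotomicZp.zpExtension 2).finiteDimensional_layer_holds 1
  haveI : NumberField ↥ℚ⟮θ⟯ := NumberField.mk
  haveI : NumberField ↥(ℚ⟮θ⟯ ⊔ (CyclotomicZp.zpExtension 2).layer 1) := NumberField.mk
  obtain ⟨hreal, hfinA, h3⟩ := layer_one_basics_d63644 hθ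
  haveI := hreal
  obtain ⟨t, ht, ht2⟩ := CyclotomicZp.exists_mem_layer_one_sq_eq_two_zpExtension
  have hKA : ℚ⟮θ⟯ ≤ ℚ⟮θ⟯ ⊔ (CyclotomicZp.zpExtension 2).layer 1 := le_sup_left
  have htA : t ∈ ℚ⟮θ⟯ ⊔ (CyclotomicZp.zpExtension 2).layer 1 := (le_sup_right : (CyclotomicZp.zpExtension 2).layer 1 ≤ _) ht
  set t' : ↥(ℚ⟮θ⟯ ⊔ (CyclotomicZp.zpExtension 2).layer 1) := ⟨t, htA⟩ with ht'def
  have ht'2 : t' ^ 2 = 2 := by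
    apply (algebraMap ↥(ℚ⟮θ⟯ ⊔ (CyclotomicZp.zpExtension 2).layer 1) (AlgebraicClosure ℚ)).injective
    rw [map_pow, map_ofNat]
    exact ht2
  set θ' : ↥(ℚ⟮θ⟯ ⊔ (CyclotomicZp.zpExtension 2).layer 1) := inclusion hKA (AdjoinSimple.gen ℚ θ) with hθ'def
  -- layer-0 certificate: embeddings, `b`, `ε`, `u₀`
  obtain ⟨ρ₀, ρ₁, ρ₂, x₀, x₁, x₂, b, eE, uE, hρ₀, hρ₁, hρ₂, ⟨hl₀, hu₀⟩, ⟨hl₁, hu₁⟩, ⟨hl₂, hu₂⟩, -, -, -, hbθ, hb, heEb, huEb,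
    he0, he1, he2, hupos, -, -⟩ := unitCertificate_adjoin_d63644 hθ
  obtain ⟨ω, R1, R2, R3⟩ := exists_omega_d63644 ↥ℚ⟮θ⟯ b hb
  obtain ⟨hs2l, hs2u⟩ := sqrt_two_bounds'
  -- the five embeddings `(r₀,−), (r₁,+), (r₁,−), (r₂,+), (r₂,−)`
  obtain ⟨σ₁, hσ₁K, hσ₁t⟩ := exists_ringHom_sup_layer_one_d63644 hθ ht ht2 ρ₀ (-Real.sqrt 2) (Or.inr rfl)
  obtain ⟨σ₂, hσ₂K, hσ₂t⟩ := exists_ringHom_sup_layer_one_d63644 hθ ht ht2 ρ₁ (Real.sqrt 2) (Or.inl rfl)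
  obtain ⟨σ₃, hσ₃K, hσ₃t⟩ := exists_ringHom_sup_layer_one_d63644 hθ ht ht2 ρ₁ (-Real.sqrt 2) (Or.inr rfl)
  obtain ⟨σ₄, hσ₄K, hσ₄t⟩ := exists_ringHom_sup_layer_one_d63644 hθ ht ht2 ρ₂ (Real.sqrt 2) (Or.inl rfl)
  obtain ⟨σ₅, hσ₅K, hσ₅t⟩ := exists_ringHom_sup_layer_one_d63644 hθ ht ht2 ρ₂ (-Real.sqrt 2) (Or.inr rfl)
  have hσ₁θ : σ₁ θ' = x₀ := by rw [hθ'def, hσ₁K, hρ₀]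
  have hσ₂θ : σ₂ θ' = x₁ := by rw [hθ'def, hσ₂K, hρ₁]
  have hσ₃θ : σ₃ θ' = x₁ := by rw [hθ'def, hσ₃K, hρ₁]
  have hσ₄θ : σ₄ θ' = x₂ := by rw [hθ'def, hσ₄K, hρ₂]
  have hσ₅θ : σ₅ θ' = x₂ := by rw [hθ'def, hσ₅K, hρ₂]
  -- integers `bA = θ`, `ωA = ω`, `sA = √2`
  letI : Algebra ↥ℚ⟮θ⟯ ↥(ℚ⟮θ⟯ ⊔ (CyclotomicZp.zpExtension 2).layer 1) := (inclusion hKA).toRingHom.toAlgebra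
  have halg : ∀ c : ↥ℚ⟮θ⟯, algebraMap ↥ℚ⟮θ⟯ ↥(ℚ⟮θ⟯ ⊔ (CyclotomicZp.zpExtension 2).layer 1) c = inclusion hKA c := fun _ => rfl
  have hbgen' : algebraMap (𝓞 ↥ℚ⟮θ⟯) ↥ℚ⟮θ⟯ b = AdjoinSimple.gen ℚ θ := hbθ
  set bA : 𝓞 ↥(ℚ⟮θ⟯ ⊔ (CyclotomicZp.zpExtension 2).layer 1) := algebraMap (𝓞 ↥ℚ⟮θ⟯) (𝓞 ↥(ℚ⟮θ⟯ ⊔ (CyclotomicZp.zpExtension 2).layer 1)) b with hbAdef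
  set ωA : 𝓞 ↥(ℚ⟮θ⟯ ⊔ (CyclotomicZp.zpExtension 2).layer 1) := algebraMap (𝓞 ↥ℚ⟮θ⟯) (𝓞 ↥(ℚ⟮θ⟯ ⊔ (CyclotomicZp.zpExtension 2).layer 1)) ω with hωAdef
  have R1A : bA ^ 2 = 2 * ωA - 1 := by
    have h := congrArg (algebraMap (𝓞 ↥ℚ⟮θ⟯) (𝓞 ↥(ℚ⟮θ⟯ ⊔ (CyclotomicZp.zpExtension 2).layer 1))) R1
    simp only [map_sub, map_mul, map_pow, map_ofNat, map_one] at h; exact h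
  have R2A : bA * ωA = ωA + 24 * bA - 48 := by
    have h := congrArg (algebraMap (𝓞 ↥ℚ⟮θ⟯) (𝓞 ↥(ℚ⟮θ⟯ ⊔ (CyclotomicZp.zpExtension 2).layer 1))) R2
    simp only [map_sub, map_mul, map_add, map_ofNat] at h; exact h
  have R3A : ωA ^ 2 = 25 * ωA - 12 * bA - 36 := by
    have h := congrArg (algebraMap (𝓞 ↥ℚ⟮θ⟯) (𝓞 ↥(ℚ⟮θ⟯ ⊔ (CyclotomicZp.zpExtension 2).layer 1))) R3
    simp only [map_sub, map_mul, map_pow, map_ofNat] at h; exact h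
  have hbAval' : algebraMap (𝓞 ↥(ℚ⟮θ⟯ ⊔ (CyclotomicZp.zpExtension 2).layer 1)) ↥(ℚ⟮θ⟯ ⊔ (CyclotomicZp.zpExtension 2).layer 1) bA = θ' := by
    rw [hbAdef, hθ'def, ← IsScalarTower.algebraMap_apply, IsScalarTower.algebraMap_apply (𝓞 ↥ℚ⟮θ⟯) ↥ℚ⟮θ⟯ ↥(ℚ⟮θ⟯ ⊔ (CyclotomicZp.zpExtension 2).layer 1), hbgen', halg]
  have hωE : algebraMap (𝓞 ↥ℚ⟮θ⟯) ↥ℚ⟮θ⟯ ω = (1 + AdjoinSimple.gen ℚ θ ^ 2) / 2 := by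
    have h := congrArg (algebraMap (𝓞 ↥ℚ⟮θ⟯) ↥ℚ⟮θ⟯) R1
    simp only [map_sub, map_mul, map_pow, map_ofNat, map_one, hbgen'] at h
    field_simp; linear_combination -h
  have hωAval' : algebraMap (𝓞 ↥(ℚ⟮θ⟯ ⊔ (CyclotomicZp.zpExtension 2).layer 1)) ↥(ℚ⟮θ⟯ ⊔ (CyclotomicZp.zpExtension 2).layer 1) ωA = (1 + θ' ^ 2) / 2 := by
    rw [hωAdef, hθ'def, ← IsScalarTower.algebraMap_apply, IsScalarTower.algebraMap_apply (𝓞 ↥ℚ⟮θ⟯) ↥ℚ⟮θ⟯ ↥(ℚ⟮θ⟯ ⊔ (CyclotomicZp.zpExtension 2).layer 1), hωE, halg,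
      map_div₀, map_add, map_one, map_pow, map_ofNat]
  have hsint : IsIntegral ℤ t' := ⟨X ^ 2 - C 2, monic_X_pow_sub_C _ two_ne_zero, by simp [ht'2]⟩
  set sA : 𝓞 ↥(ℚ⟮θ⟯ ⊔ (CyclotomicZp.zpExtension 2).layer 1) := ⟨t', hsint⟩ with hsAdef
  have hsAval : ((sA : 𝓞 ↥(ℚ⟮θ⟯ ⊔ (CyclotomicZp.zpExtension 2).layer 1)) : ↥(ℚ⟮θ⟯ ⊔ (CyclotomicZp.zpExtension 2).layer 1)) = t' := rfl
  have hsAval' : algebraMap (𝓞 ↥(ℚ⟮θ⟯ ⊔ (CyclotomicZp.zpExtension 2).layer 1)) ↥(ℚ⟮θ⟯ ⊔ (CyclotomicZp.zpExtension 2).layer 1) sA = t' := by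
    rw [← NumberField.RingOfIntegers.coe_eq_algebraMap]; exact hsAval
  have hsA2 : sA ^ 2 = 2 := by
    apply IsFractionRing.injective (𝓞 ↥(ℚ⟮θ⟯ ⊔ (CyclotomicZp.zpExtension 2).layer 1)) ↥(ℚ⟮θ⟯ ⊔ (CyclotomicZp.zpExtension 2).layer 1)
    rw [map_pow, map_ofNat, hsAval', ht'2]
  -- the five units
  obtain ⟨hid₃, hid₄, hid₅, hidε, hiduh⟩ := layer_unit_ids_d63644 bA ωA sA R1A R2A R3A hsA2
  set e₂ : (𝓞 ↥(ℚ⟮θ⟯ ⊔ (CyclotomicZp.zpExtension 2).layer 1))ˣ := Units.mkOfMulEqOne _ _ hidε with he₂def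
  set e₃ : (𝓞 ↥(ℚ⟮θ⟯ ⊔ (CyclotomicZp.zpExtension 2).layer 1))ˣ := Units.mkOfMulEqOne _ _ hid₃ with he₃def
  set e₄ : (𝓞 ↥(ℚ⟮θ⟯ ⊔ (CyclotomicZp.zpExtension 2).layer 1))ˣ := Units.mkOfMulEqOne _ _ hid₄ with he₄def
  set e₅ : (𝓞 ↥(ℚ⟮θ⟯ ⊔ (CyclotomicZp.zpExtension 2).layer 1))ˣ := Units.mkOfMulEqOne _ _ hid₅ with he₅def
  -- values under an embedding `σ` with `σ θ' = x`, `σ t' = y`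
  have hval : ∀ (σ : ↥(ℚ⟮θ⟯ ⊔ (CyclotomicZp.zpExtension 2).layer 1) →+* ℝ) (x y : ℝ), σ θ' = x → σ t' = y →
      σ (algebraMap (𝓞 ↥(ℚ⟮θ⟯ ⊔ (CyclotomicZp.zpExtension 2).layer 1)) ↥(ℚ⟮θ⟯ ⊔ (CyclotomicZp.zpExtension 2).layer 1) bA) = x ∧ σ (algebraMap (𝓞 ↥(ℚ⟮θ⟯ ⊔ (CyclotomicZp.zpExtension 2).layer 1)) ↥(ℚ⟮θ⟯ ⊔ (CyclotomicZp.zpExtension 2).layer 1) ωA) = (1 + x ^ 2) / 2 ∧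
        σ (algebraMap (𝓞 ↥(ℚ⟮θ⟯ ⊔ (CyclotomicZp.zpExtension 2).layer 1)) ↥(ℚ⟮θ⟯ ⊔ (CyclotomicZp.zpExtension 2).layer 1) sA) = y := by
    intro σ x y hx hy
    refine ⟨by rw [hbAval', hx], ?_, by rw [hsAval', hy]⟩
    rw [hωAval', map_div₀, map_add, map_one, map_pow, map_ofNat, hx]
  have hv₂ : ∀ (σ : ↥(ℚ⟮θ⟯ ⊔ (CyclotomicZp.zpExtension 2).layer 1) →+* ℝ) (x y : ℝ), σ θ' = x → σ t' = y →
      σ ((e₂ : 𝓞 ↥(ℚ⟮θ⟯ ⊔ (CyclotomicZp.zpExtension 2).layer 1)) : ↥(ℚ⟮θ⟯ ⊔ (CyclotomicZp.zpExtension 2).layer 1)) = -10969 + 278 * x + 246 * x ^ 2 := by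
    intro σ x y hx hy
    obtain ⟨h1, h2, h3⟩ := hval σ x y hx hy
    rw [he₂def, Units.val_mkOfMulEqOne, NumberField.RingOfIntegers.coe_eq_algebraMap]
    simp only [map_add, map_mul, map_pow, map_neg, map_ofNat, h1]
  have hv₃ : ∀ (σ : ↥(ℚ⟮θ⟯ ⊔ (CyclotomicZp.zpExtension 2).layer 1) →+* ℝ) (x y : ℝ), σ θ' = x → σ t' = y → σ ((e₃ : 𝓞 ↥(ℚ⟮θ⟯ ⊔ (CyclotomicZp.zpExtension 2).layer 1)) : ↥(ℚ⟮θ⟯ ⊔ (CyclotomicZp.zpExtension 2).layer 1)) = 1 + y := by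
    intro σ x y hx hy
    obtain ⟨h1, h2, h3⟩ := hval σ x y hx hy
    rw [he₃def, Units.val_mkOfMulEqOne, NumberField.RingOfIntegers.coe_eq_algebraMap]
    simp only [map_add, map_one, h3]
  have hv₄ : ∀ (σ : ↥(ℚ⟮θ⟯ ⊔ (CyclotomicZp.zpExtension 2).layer 1) →+* ℝ) (x y : ℝ), σ θ' = x → σ t' = y →
      σ ((e₄ : 𝓞 ↥(ℚ⟮θ⟯ ⊔ (CyclotomicZp.zpExtension 2).layer 1)) : ↥(ℚ⟮θ⟯ ⊔ (CyclotomicZp.zpExtension 2).layer 1)) = (12 - 5 * x) + (x - (1 + x ^ 2) / 2) * y ∧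
      σ (algebraMap (𝓞 ↥(ℚ⟮θ⟯ ⊔ (CyclotomicZp.zpExtension 2).layer 1)) ↥(ℚ⟮θ⟯ ⊔ (CyclotomicZp.zpExtension 2).layer 1) ((12 - 5 * bA) - (bA - ωA) * sA)) = (12 - 5 * x) - (x - (1 + x ^ 2) / 2) * y := by
    intro σ x y hx hy
    obtain ⟨h1, h2, h3⟩ := hval σ x y hx hy
    rw [he₄def, Units.val_mkOfMulEqOne, NumberField.RingOfIntegers.coe_eq_algebraMap]
    simp only [map_add, map_sub, map_mul, map_ofNat, h1, h2, h3]
    exact ⟨trivial, trivial⟩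
  have hv₅ : ∀ (σ : ↥(ℚ⟮θ⟯ ⊔ (CyclotomicZp.zpExtension 2).layer 1) →+* ℝ) (x y : ℝ), σ θ' = x → σ t' = y →
      σ ((e₅ : 𝓞 ↥(ℚ⟮θ⟯ ⊔ (CyclotomicZp.zpExtension 2).layer 1)) : ↥(ℚ⟮θ⟯ ⊔ (CyclotomicZp.zpExtension 2).layer 1)) = (-580 + 283 * x + 98 * ((1 + x ^ 2) / 2)) + (845 - 191 * x - 83 * ((1 + x ^ 2) / 2)) * y ∧
      σ (algebraMap (𝓞 ↥(ℚ⟮θ⟯ ⊔ (CyclotomicZp.zpExtension 2).layer 1)) ↥(ℚ⟮θ⟯ ⊔ (CyclotomicZp.zpExtension 2).layer 1) (((-580 + 283 * bA + 98 * ωA) - (845 - 191 * bA - 83 * ωA) * sA) *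
          (16593903 - 11362268 * bA + 2748892 * ωA))) =
        ((-580 + 283 * x + 98 * ((1 + x ^ 2) / 2)) - (845 - 191 * x - 83 * ((1 + x ^ 2) / 2)) * y) *
          (16593903 - 11362268 * x + 2748892 * ((1 + x ^ 2) / 2)) ∧
      σ (algebraMap (𝓞 ↥(ℚ⟮θ⟯ ⊔ (CyclotomicZp.zpExtension 2).layer 1)) ↥(ℚ⟮θ⟯ ⊔ (CyclotomicZp.zpExtension 2).layer 1) (16593903 - 11362268 * bA + 2748892 * ωA)) *
        σ (algebraMap (𝓞 ↥(ℚ⟮θ⟯ ⊔ (CyclotomicZp.zpExtension 2).layer 1)) ↥(ℚ⟮θ⟯ ⊔ (CyclotomicZp.zpExtension 2).layer 1) (567201 - 176732 * bA - 68820 * ωA)) = -1 ∧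
      σ (algebraMap (𝓞 ↥(ℚ⟮θ⟯ ⊔ (CyclotomicZp.zpExtension 2).layer 1)) ↥(ℚ⟮θ⟯ ⊔ (CyclotomicZp.zpExtension 2).layer 1) (567201 - 176732 * bA - 68820 * ωA)) = 567201 - 176732 * x - 68820 * ((1 + x ^ 2) / 2) := by
    intro σ x y hx hy
    obtain ⟨h1, h2, h3⟩ := hval σ x y hx hy
    have huh : σ (algebraMap (𝓞 ↥(ℚ⟮θ⟯ ⊔ (CyclotomicZp.zpExtension 2).layer 1)) ↥(ℚ⟮θ⟯ ⊔ (CyclotomicZp.zpExtension 2).layer 1) ((16593903 - 11362268 * bA + 2748892 * ωA) * (-(567201 - 176732 * bA - 68820 * ωA)))) = 1 := by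
      rw [hiduh, map_one, map_one]
    rw [map_mul, map_neg (algebraMap (𝓞 ↥(ℚ⟮θ⟯ ⊔ (CyclotomicZp.zpExtension 2).layer 1)) ↥(ℚ⟮θ⟯ ⊔ (CyclotomicZp.zpExtension 2).layer 1)), map_mul, map_neg] at huh
    refine ⟨?_, ?_, by linear_combination -huh, ?_⟩
    · rw [he₅def, Units.val_mkOfMulEqOne, NumberField.RingOfIntegers.coe_eq_algebraMap]
      simp only [map_add, map_sub, map_mul, map_neg, map_ofNat, h1, h2, h3]
    · simp only [map_add, map_sub, map_mul, map_neg, map_ofNat, h1, h2, h3]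
    · simp only [map_sub, map_mul, map_ofNat, h1, h2]
  -- the inverse trick: `σ(e) · σ(e') = 1`
  have hinv : ∀ (σ : ↥(ℚ⟮θ⟯ ⊔ (CyclotomicZp.zpExtension 2).layer 1) →+* ℝ) (a c : 𝓞 ↥(ℚ⟮θ⟯ ⊔ (CyclotomicZp.zpExtension 2).layer 1)), a * c = 1 →
      σ (algebraMap (𝓞 ↥(ℚ⟮θ⟯ ⊔ (CyclotomicZp.zpExtension 2).layer 1)) ↥(ℚ⟮θ⟯ ⊔ (CyclotomicZp.zpExtension 2).layer 1) a) * σ (algebraMap (𝓞 ↥(ℚ⟮θ⟯ ⊔ (CyclotomicZp.zpExtension 2).layer 1)) ↥(ℚ⟮θ⟯ ⊔ (CyclotomicZp.zpExtension 2).layer 1) c) = 1 := by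
    intro σ a c h
    rw [← map_mul, ← map_mul, h, map_one, map_one]
  -- sign bits
  have sneg : ∀ (σ : ↥(ℚ⟮θ⟯ ⊔ (CyclotomicZp.zpExtension 2).layer 1) →+* ℝ) (e : (𝓞 ↥(ℚ⟮θ⟯ ⊔ (CyclotomicZp.zpExtension 2).layer 1))ˣ), σ ((e : 𝓞 ↥(ℚ⟮θ⟯ ⊔ (CyclotomicZp.zpExtension 2).layer 1)) : ↥(ℚ⟮θ⟯ ⊔ (CyclotomicZp.zpExtension 2).layer 1)) < 0 → signVec e σ = 1 :=
    fun σ e h => by rw [signVec_apply, if_pos h]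
  have spos : ∀ (σ : ↥(ℚ⟮θ⟯ ⊔ (CyclotomicZp.zpExtension 2).layer 1) →+* ℝ) (e : (𝓞 ↥(ℚ⟮θ⟯ ⊔ (CyclotomicZp.zpExtension 2).layer 1))ˣ), 0 < σ ((e : 𝓞 ↥(ℚ⟮θ⟯ ⊔ (CyclotomicZp.zpExtension 2).layer 1)) : ↥(ℚ⟮θ⟯ ⊔ (CyclotomicZp.zpExtension 2).layer 1)) → signVec e σ = 0 :=
    fun σ e h => by rw [signVec_apply, if_neg (not_lt.mpr h.le)]
  -- E-level sign facts (quadratics in `x` at the located roots)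
  have X4pos0 : 0 < (12 : ℝ) - 5 * x₀ := by linarith
  have X4pos1 : 0 < (12 : ℝ) - 5 * x₁ := by linarith
  have X4neg2 : (12 : ℝ) - 5 * x₂ < 0 := by linarith
  have Y4neg0 : x₀ - (1 + x₀ ^ 2) / 2 < 0 := by nlinarith [sq_nonneg (x₀ - 1)]
  have Y4neg1 : x₁ - (1 + x₁ ^ 2) / 2 < 0 := by nlinarith [sq_nonneg (x₁ - 1)]
  have Y4neg2 : x₂ - (1 + x₂ ^ 2) / 2 < 0 := by nlinarith [sq_nonneg (x₂ - 1)]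
  have X5pos0 : 0 < -580 + 283 * x₀ + 98 * ((1 + x₀ ^ 2) / 2) := by
    have h := quadratic_pos_of_endpoints (a₀ := -531) (a₁ := 283) (a₂ := 49) (m := 76 / 10000) hl₀.le hu₀.le
      (by norm_num) (by norm_num) (by norm_num) (by norm_num)
    linarith
  have X5pos1 : 0 < -580 + 283 * x₁ + 98 * ((1 + x₁ ^ 2) / 2) := by
    have h := quadratic_pos_of_endpoints (a₀ := -531) (a₁ := 283) (a₂ := 49) (m := 1) hl₁.le hu₁.le
      (by norm_num) (by norm_num) (by norm_num) (by norm_num)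
    linarith
  have X5pos2 : 0 < -580 + 283 * x₂ + 98 * ((1 + x₂ ^ 2) / 2) := by
    have h := quadratic_pos_of_endpoints (a₀ := -531) (a₁ := 283) (a₂ := 49) (m := 1) hl₂.le hu₂.le
      (by norm_num) (by norm_num) (by norm_num) (by norm_num)
    linarith
  have Y5neg0 : 845 - 191 * x₀ - 83 * ((1 + x₀ ^ 2) / 2) < 0 := by
    have h := quadratic_neg_of_endpoints (a₀ := 1607 / 2) (a₁ := -191) (a₂ := -83 / 2) (m := 54 / 10000) hl₀.le hu₀.le
      (by norm_num) (by norm_num) (by norm_num) (by norm_num)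
    linarith
  have Y5pos1 : 0 < 845 - 191 * x₁ - 83 * ((1 + x₁ ^ 2) / 2) := by
    have h := quadratic_pos_of_endpoints (a₀ := 1607 / 2) (a₁ := -191) (a₂ := -83 / 2) (m := 1) hl₁.le hu₁.le
      (by norm_num) (by norm_num) (by norm_num) (by norm_num)
    linarith
  have Y5neg2 : 845 - 191 * x₂ - 83 * ((1 + x₂ ^ 2) / 2) < 0 := by
    have h := quadratic_neg_of_endpoints (a₀ := 1607 / 2) (a₁ := -191) (a₂ := -83 / 2) (m := 1) hl₂.le hu₂.le
      (by norm_num) (by norm_num) (by norm_num) (by norm_num)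
    linarith
  have H2pos1 : 0 < 567201 - 176732 * x₁ - 68820 * ((1 + x₁ ^ 2) / 2) := by
    have h := quadratic_pos_of_endpoints (a₀ := 532791) (a₁ := -176732) (a₂ := -34410) (m := 1) hl₁.le hu₁.le
      (by norm_num) (by norm_num) (by norm_num) (by norm_num)
    linarith
  have H2neg2 : 567201 - 176732 * x₂ - 68820 * ((1 + x₂ ^ 2) / 2) < 0 := by
    have h := quadratic_neg_of_endpoints (a₀ := 532791) (a₁ := -176732) (a₂ := -34410) (m := 1) hl₂.le hu₂.le
      (by norm_num) (by norm_num) (by norm_num) (by norm_num)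
    linarith
  have hs2pos : 0 < Real.sqrt 2 := by linarith
  -- the sign matrix
  have hM : ∀ i j, signVec (![-1, e₂, e₃, e₄, e₅] i) (![σ₁, σ₂, σ₃, σ₄, σ₅] j) =
      !![(1 : ZMod 2), 1, 1, 1, 1; 0, 1, 1, 0, 0; 1, 0, 1, 0, 1; 0, 0, 0, 1, 1; 0, 0, 1, 0, 0] i j := by
    intro i j
    fin_cases i
    · fin_cases j <;> (show signVec (-1) _ = 1) <;> rw [signVec_neg_one]
    · -- `ε` from `E`: its values are `ρ_k(ε)`
      have hεval : ∀ (σ : ↥(ℚ⟮θ⟯ ⊔ (CyclotomicZp.zpExtension 2).layer 1) →+* ℝ) (ρ : ↥ℚ⟮θ⟯ →+* ℝ), (∀ c, σ (inclusion hKA c) = ρ c) →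
          σ ((e₂ : 𝓞 ↥(ℚ⟮θ⟯ ⊔ (CyclotomicZp.zpExtension 2).layer 1)) : ↥(ℚ⟮θ⟯ ⊔ (CyclotomicZp.zpExtension 2).layer 1)) = ρ ((eE : 𝓞 ↥ℚ⟮θ⟯) : ↥ℚ⟮θ⟯) := by
        intro σ ρ hσρ
        rw [he₂def, Units.val_mkOfMulEqOne, NumberField.RingOfIntegers.coe_eq_algebraMap, heEb,
          NumberField.RingOfIntegers.coe_eq_algebraMap]
        simp only [map_add, map_mul, map_pow, map_neg, map_ofNat, hbAval', hbgen', hθ'def, hσρ]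
      fin_cases j
      · show signVec e₂ σ₁ = 0; exact spos _ _ (by rw [hεval σ₁ ρ₀ hσ₁K]; exact he0)
      · show signVec e₂ σ₂ = 1; exact sneg _ _ (by rw [hεval σ₂ ρ₁ hσ₂K]; exact he1)
      · show signVec e₂ σ₃ = 1; exact sneg _ _ (by rw [hεval σ₃ ρ₁ hσ₃K]; exact he1)
      · show signVec e₂ σ₄ = 0; exact spos _ _ (by rw [hεval σ₄ ρ₂ hσ₄K]; exact he2)
      · show signVec e₂ σ₅ = 0; exact spos _ _ (by rw [hεval σ₅ ρ₂ hσ₅K]; exact he2)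
    · fin_cases j
      · show signVec e₃ σ₁ = 1; exact sneg _ _ (by rw [hv₃ σ₁ _ _ hσ₁θ hσ₁t]; linarith)
      · show signVec e₃ σ₂ = 0; exact spos _ _ (by rw [hv₃ σ₂ _ _ hσ₂θ hσ₂t]; linarith)
      · show signVec e₃ σ₃ = 1; exact sneg _ _ (by rw [hv₃ σ₃ _ _ hσ₃θ hσ₃t]; linarith)
      · show signVec e₃ σ₄ = 0; exact spos _ _ (by rw [hv₃ σ₄ _ _ hσ₄θ hσ₄t]; linarith)
      · show signVec e₃ σ₅ = 1; exact sneg _ _ (by rw [hv₃ σ₅ _ _ hσ₅θ hσ₅t]; linarith)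
    · fin_cases j
      · show signVec e₄ σ₁ = 0
        exact spos _ _ (by rw [(hv₄ σ₁ _ _ hσ₁θ hσ₁t).1]; have hp := mul_pos (neg_pos.mpr Y4neg0) hs2pos; linarith)
      · show signVec e₄ σ₂ = 0
        refine spos _ _ (pos_of_mul_eq_one ?_ (c := σ₂ (algebraMap (𝓞 ↥(ℚ⟮θ⟯ ⊔ (CyclotomicZp.zpExtension 2).layer 1)) ↥(ℚ⟮θ⟯ ⊔ (CyclotomicZp.zpExtension 2).layer 1) ((12 - 5 * bA) - (bA - ωA) * sA))) ?_)
        · rw [NumberField.RingOfIntegers.coe_eq_algebraMap, he₄def, Units.val_mkOfMulEqOne]; exact hinv σ₂ _ _ hid₄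
        · rw [(hv₄ σ₂ _ _ hσ₂θ hσ₂t).2]; have hp := mul_pos (neg_pos.mpr Y4neg1) hs2pos; linarith
      · show signVec e₄ σ₃ = 0
        exact spos _ _ (by rw [(hv₄ σ₃ _ _ hσ₃θ hσ₃t).1]; have hp := mul_pos (neg_pos.mpr Y4neg1) hs2pos; linarith)
      · show signVec e₄ σ₄ = 1
        exact sneg _ _ (by rw [(hv₄ σ₄ _ _ hσ₄θ hσ₄t).1]; have hp := mul_pos (neg_pos.mpr Y4neg2) hs2pos; linarith)
      · show signVec e₄ σ₅ = 1
        refine sneg _ _ (neg_of_mul_eq_one ?_ (c := σ₅ (algebraMap (𝓞 ↥(ℚ⟮θ⟯ ⊔ (CyclotomicZp.zpExtension 2).layer 1)) ↥(ℚ⟮θ⟯ ⊔ (CyclotomicZp.zpExtension 2).layer 1) ((12 - 5 * bA) - (bA - ωA) * sA))) ?_)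
        · rw [NumberField.RingOfIntegers.coe_eq_algebraMap, he₄def, Units.val_mkOfMulEqOne]; exact hinv σ₅ _ _ hid₄
        · rw [(hv₄ σ₅ _ _ hσ₅θ hσ₅t).2]; have hp := mul_pos (neg_pos.mpr Y4neg2) hs2pos; linarith
    · fin_cases j
      · show signVec e₅ σ₁ = 0
        exact spos _ _ (by rw [(hv₅ σ₁ _ _ hσ₁θ hσ₁t).1]; have hp := mul_pos (neg_pos.mpr Y5neg0) hs2pos; linarith)
      · show signVec e₅ σ₂ = 0
        exact spos _ _ (by rw [(hv₅ σ₂ _ _ hσ₂θ hσ₂t).1]; have hp := mul_pos Y5pos1 hs2pos; linarith)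
      · show signVec e₅ σ₃ = 1
        obtain ⟨-, hw, huh, hh2⟩ := hv₅ σ₃ _ _ hσ₃θ hσ₃t
        refine sneg _ _ (neg_of_mul_eq_one ?_ (c := σ₃ (algebraMap (𝓞 ↥(ℚ⟮θ⟯ ⊔ (CyclotomicZp.zpExtension 2).layer 1)) ↥(ℚ⟮θ⟯ ⊔ (CyclotomicZp.zpExtension 2).layer 1)
          ((((-580 + 283 * bA + 98 * ωA) - (845 - 191 * bA - 83 * ωA) * sA) * (16593903 - 11362268 * bA + 2748892 * ωA))))) ?_)
        · rw [NumberField.RingOfIntegers.coe_eq_algebraMap, he₅def, Units.val_mkOfMulEqOne]; exact hinv σ₃ _ _ hid₅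
        · -- `σ₃(ē₅) > 0`, `σ₃(u) = −1/σ₃(h₂) < 0`
          have hupos : σ₃ (algebraMap (𝓞 ↥(ℚ⟮θ⟯ ⊔ (CyclotomicZp.zpExtension 2).layer 1)) ↥(ℚ⟮θ⟯ ⊔ (CyclotomicZp.zpExtension 2).layer 1) (16593903 - 11362268 * bA + 2748892 * ωA)) < 0 :=
            neg_of_mul_eq_neg_one huh (by rw [hh2]; exact H2pos1)
          rw [map_mul, map_mul]
          have hbar : 0 < σ₃ (algebraMap (𝓞 ↥(ℚ⟮θ⟯ ⊔ (CyclotomicZp.zpExtension 2).layer 1)) ↥(ℚ⟮θ⟯ ⊔ (CyclotomicZp.zpExtension 2).layer 1) ((-580 + 283 * bA + 98 * ωA) - (845 - 191 * bA - 83 * ωA) * sA)) := by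
            obtain ⟨h1, h2, h3⟩ := hval σ₃ _ _ hσ₃θ hσ₃t
            simp only [map_add, map_sub, map_mul, map_neg, map_ofNat, h1, h2, h3]
            have hp := mul_pos Y5pos1 hs2pos; linarith
          exact mul_neg_of_pos_of_neg hbar hupos
      · show signVec e₅ σ₄ = 0
        obtain ⟨-, hw, huh, hh2⟩ := hv₅ σ₄ _ _ hσ₄θ hσ₄t
        refine spos _ _ (pos_of_mul_eq_one ?_ (c := σ₄ (algebraMap (𝓞 ↥(ℚ⟮θ⟯ ⊔ (CyclotomicZp.zpExtension 2).layer 1)) ↥(ℚ⟮θ⟯ ⊔ (CyclotomicZp.zpExtension 2).layer 1)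
          ((((-580 + 283 * bA + 98 * ωA) - (845 - 191 * bA - 83 * ωA) * sA) * (16593903 - 11362268 * bA + 2748892 * ωA))))) ?_)
        · rw [NumberField.RingOfIntegers.coe_eq_algebraMap, he₅def, Units.val_mkOfMulEqOne]; exact hinv σ₄ _ _ hid₅
        · have hupos : 0 < σ₄ (algebraMap (𝓞 ↥(ℚ⟮θ⟯ ⊔ (CyclotomicZp.zpExtension 2).layer 1)) ↥(ℚ⟮θ⟯ ⊔ (CyclotomicZp.zpExtension 2).layer 1) (16593903 - 11362268 * bA + 2748892 * ωA)) :=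
            pos_of_mul_eq_neg_one huh (by rw [hh2]; exact H2neg2)
          rw [map_mul, map_mul]
          have hbar : 0 < σ₄ (algebraMap (𝓞 ↥(ℚ⟮θ⟯ ⊔ (CyclotomicZp.zpExtension 2).layer 1)) ↥(ℚ⟮θ⟯ ⊔ (CyclotomicZp.zpExtension 2).layer 1) ((-580 + 283 * bA + 98 * ωA) - (845 - 191 * bA - 83 * ωA) * sA)) := by
            obtain ⟨h1, h2, h3⟩ := hval σ₄ _ _ hσ₄θ hσ₄t
            simp only [map_add, map_sub, map_mul, map_neg, map_ofNat, h1, h2, h3]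
            have hp := mul_pos (neg_pos.mpr Y5neg2) hs2pos; linarith
          exact mul_pos hbar hupos
      · show signVec e₅ σ₅ = 0
        exact spos _ _ (by rw [(hv₅ σ₅ _ _ hσ₅θ hσ₅t).1]; have hp := mul_pos (neg_pos.mpr Y5neg2) hs2pos; linarith)
  have hMunit : IsUnit (!![(1 : ZMod 2), 1, 1, 1, 1; 0, 1, 1, 0, 0; 1, 0, 1, 0, 1; 0, 0, 0, 1, 1; 0, 0, 1, 0, 0]) := by
    haveI := invertibleOfRightInverse
      (!![(1 : ZMod 2), 1, 1, 1, 1; 0, 1, 1, 0, 0; 1, 0, 1, 0, 1; 0, 0, 0, 1, 1; 0, 0, 1, 0, 0])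
      !![(1 : ZMod 2), 1, 0, 1, 0; 0, 1, 0, 0, 1; 0, 0, 0, 0, 1; 1, 1, 1, 0, 1; 1, 1, 1, 1, 1] (by decide)
    exact isUnit_of_invertible _
  have hsig := two_pow_le_card_range_signVec ![-1, e₂, e₃, e₄, e₅] ![σ₁, σ₂, σ₃, σ₄, σ₅] _ hM hMunit
  -- the totally positive non-square `u₀`
  set eU : (𝓞 ↥(ℚ⟮θ⟯ ⊔ (CyclotomicZp.zpExtension 2).layer 1))ˣ := Units.map (algebraMap (𝓞 ↥ℚ⟮θ⟯) (𝓞 ↥(ℚ⟮θ⟯ ⊔ (CyclotomicZp.zpExtension 2).layer 1)) : 𝓞 ↥ℚ⟮θ⟯ →* 𝓞 ↥(ℚ⟮θ⟯ ⊔ (CyclotomicZp.zpExtension 2).layer 1)) uE with heUdef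
  have heUval : ((eU : 𝓞 ↥(ℚ⟮θ⟯ ⊔ (CyclotomicZp.zpExtension 2).layer 1)) : ↥(ℚ⟮θ⟯ ⊔ (CyclotomicZp.zpExtension 2).layer 1)) = inclusion hKA (1027839 - 26042 * AdjoinSimple.gen ℚ θ - 23048 * AdjoinSimple.gen ℚ θ ^ 2) := by
    rw [heUdef, Units.coe_map, MonoidHom.coe_coe, NumberField.RingOfIntegers.coe_eq_algebraMap, ← IsScalarTower.algebraMap_apply,
      IsScalarTower.algebraMap_apply (𝓞 ↥ℚ⟮θ⟯) ↥ℚ⟮θ⟯ ↥(ℚ⟮θ⟯ ⊔ (CyclotomicZp.zpExtension 2).layer 1), huEb, halg]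
    simp only [map_sub, map_mul, map_pow, map_ofNat, hbgen']
  have heUval' : ((eU : 𝓞 ↥(ℚ⟮θ⟯ ⊔ (CyclotomicZp.zpExtension 2).layer 1)) : ↥(ℚ⟮θ⟯ ⊔ (CyclotomicZp.zpExtension 2).layer 1)) = inclusion hKA ((uE : 𝓞 ↥ℚ⟮θ⟯) : ↥ℚ⟮θ⟯) := by
    rw [heUval, NumberField.RingOfIntegers.coe_eq_algebraMap, huEb]
    simp only [map_sub, map_mul, map_pow, map_ofNat, hbgen']
  have hpos : ∀ σ : ↥(ℚ⟮θ⟯ ⊔ (CyclotomicZp.zpExtension 2).layer 1) →+* ℝ, 0 < σ ((eU : 𝓞 ↥(ℚ⟮θ⟯ ⊔ (CyclotomicZp.zpExtension 2).layer 1)) : ↥(ℚ⟮θ⟯ ⊔ (CyclotomicZp.zpExtension 2).layer 1)) := fun σ => by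
    rw [heUval', show σ (inclusion hKA ((uE : 𝓞 ↥ℚ⟮θ⟯) : ↥ℚ⟮θ⟯)) =
      (σ.comp (inclusion hKA).toRingHom) ((uE : 𝓞 ↥ℚ⟮θ⟯) : ↥ℚ⟮θ⟯) from rfl]
    exact hupos _
  have hns := not_exists_sq_eq_u0_sup_layer_one_d63644 hθ ht ht2 eU heUval
  have htwo := two_le_card_totPosUnitsModSq_of_not_sq eU hpos hns
  exact card_totPosUnitsModSq_eq_two_of_bounds (n := 5) hfinA hsig htwo

end Summit.BirchSwinnertonDyer.BirchSwinnertonDyer.Theorems.AddKatoTwo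

end
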